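import Summits.QuantumFields.YangMills.Theorems.BalabanUVNodesN15KingModelMasslessOSGaplessBound

/-!
# BalabanUVNodes ∕ N15 — THE KING-MODEL RUNG (PART Ͳ-g): THE CLUSTERING RATES ARE SHARP ON THE MEASURE SIDE — the massive block field does NOT cluster at any rate `m′ > √m²`,
# and the massless block field does NOT cluster exponentially at ANY rate (the tree's `HasTimeClustering`, no Hilbert space needed)
# (Track A, DAG node N15 = NE2; FAN-OUT v1.1 §N15 s3 «KING-MODEL RUNG»; count-neutral)

HONEST FRAMING.  Count-neutral (cell `pub-ymgap`, seat `pub-ymgap-dag-n15-e` g36; `--supports stmt-QuantumFields-27366 --as helper` = K3⁸).  King's `A = 0`, `g = 0` model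
([King1986] C. King, Commun. Math. Phys. **102** (1986) 649–677).  Part Ͳ-d₃ proved `HasTimeClustering μ_∞ θ* S 𝓔₊ (√m²)`; here the converse statements, directly on the measures
(witness `F = G = e^{iφ(0)}`, parts Ͳ-e₁∕Ͳ-f₃): ★★★ **`king_not_hasTimeClustering_of_gt`** — for `m′ > √m²`, `¬ HasTimeClustering μ_∞ θ* S 𝓔₊ m′` (the truncated pairing has `t`-th root
`→ e^{−√m²} > e^{−m′}`); ★★★ **`king0_not_hasTimeClustering`** — for every `m > 0`, `¬ HasTimeClustering μ⁰_∞ θ* S 𝓔₊ m` (`d + 1 ≥ 3`; polynomial lower bound versus `C e^{−mt}`).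
So `√m²` is exactly the supremal clustering rate of the massive block field and the critical field has none.  NOT Bałaban's objects; NOT a node discharge; nothing about
Yang–Mills ∕ continuum ∕ `ℝ⁴` ∕ Clay.  0 `sorry`, 0 def; standard axioms.

WHAT THIS FILE PROVES (kernel).  `exp_neg_mul_nat_eq_pow`, `exists_const_mul_pow_lt_onePoint0_lowerBound`, ★★★ **`king0_not_hasTimeClustering`**, ★★★ **`king_not_hasTimeClustering_of_gt`**.

HONEST SCOPE.  King's free block fields (massive: every `d`, `m² > 0`; massless: `d + 1 ≥ 3`).  N15 untouched; counts unmoved.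
Locators (use): [King1986] Thm 2.1 (2.22)–(2.23) p.654, Thm 3.3 (3.6) p.656; Glimm–Jaffe 1987 §19.7 Thm. 19.7.1.
-/

noncomputable section

open scoped BigOperators Topology ComplexConjugate
open Filter MeasureTheory ProbabilityTheory Finset Complex

namespace Summit.QuantumFields.YangMills.BalabanUVNodes.N15KingModelRung.InfiniteVolume

open Literature.MathematicalPhysics.QuantumFieldTheory (latticeTimeReflection positiveTimeSites positiveTimeEvents latticeTimeShift)
open Literature.Probability.LatticeModels (configReflect IsBoundedMeasurable HasTimeClustering)
open Summit.QuantumFields.YangMills.BalabanUVNodes.N15KingModelRung.OptimalDecay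
open Summit.QuantumFields.YangMills.BalabanUVNodes.N15KingModelRung.ProperTime

variable {d : ℕ}

/-- `e^{−mt} = (e^{−m})^t`. [folklore] -/
theorem exp_neg_mul_nat_eq_pow (m : ℝ) (t : ℕ) : Real.exp (-m * t) = Real.exp (-m) ^ t := by
  rw [← Real.exp_nat_mul]; ring_nf

/-- For `0 ≤ r < 1` and any `C`, some `t` has `C·r^t < e^{−S₂^{0}(0)}S₂^{0}(e₀ + te₀)` (polynomial versus geometric). [cite: King1986, Thm 2.1 (2.22) p.654] -/
theorem exists_const_mul_pow_lt_onePoint0_lowerBound (hd : 2 ≤ d) (C : ℝ) {r : ℝ} (hr0 : 0 ≤ r) (hr1 : r < 1) :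
    ∃ t : ℕ, C * r ^ t < Real.exp (-kingS2Inf0 (0 : Fin (d + 1) → ℤ)) * kingS2Inf0 ((Pi.single 0 1 : Fin (d + 1) → ℤ) + (t : ℤ) • (Pi.single 0 (1 : ℤ) : Fin (d + 1) → ℤ)) := by
  by_cases hC : C ≤ 0
  · exact ⟨0, (mul_nonpos_of_nonpos_of_nonneg hC (pow_nonneg hr0 0)).trans_lt (mul_pos (Real.exp_pos _) (kingS2Inf0_pos hd _))⟩
  push Not at hC
  set c : ℝ := Real.exp (-kingS2Inf0 (0 : Fin (d + 1) → ℤ)) * (Real.Gamma (((d : ℝ) - 1) / 2) / (4 * Real.pi ^ (((d : ℝ) + 1) / 2))) with hc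
  have hΓ : 0 < Real.Gamma (((d : ℝ) - 1) / 2) := Real.Gamma_pos_of_pos (by
    have : (2 : ℝ) ≤ d := by exact_mod_cast hd
    linarith)
  have hc0 : 0 < c := by positivity
  have hlim : Tendsto (fun t : ℕ => C * ((d : ℝ) + 3) ^ (d - 1) * ((t : ℝ) ^ (d - 1) * r ^ t)) atTop (𝓝 0) := by
    have h := (tendsto_pow_const_mul_const_pow_of_lt_one (d - 1) hr0 hr1).const_mul (C * ((d : ℝ) + 3) ^ (d - 1))
    rw [mul_zero] at h
    exact h
  obtain ⟨t, hlt, ht1⟩ := ((hlim.eventually (gt_mem_nhds hc0)).and (eventually_ge_atTop 1)).exists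
  refine ⟨t, ?_⟩
  have ht1' : (1 : ℝ) ≤ t := by exact_mod_cast ht1
  have hpoly : ((t : ℝ) + d + 2) ^ (d - 1) ≤ ((d : ℝ) + 3) ^ (d - 1) * (t : ℝ) ^ (d - 1) := by
    rw [← mul_pow]
    exact pow_le_pow_left₀ (by positivity) (by nlinarith [(Nat.cast_nonneg d : (0 : ℝ) ≤ d)]) _
  have hpos : 0 < ((t : ℝ) + d + 2) ^ (d - 1) := by positivity
  have hkey : C * r ^ t * ((t : ℝ) + d + 2) ^ (d - 1) < c := by
    calc C * r ^ t * ((t : ℝ) + d + 2) ^ (d - 1) ≤ C * r ^ t * (((d : ℝ) + 3) ^ (d - 1) * (t : ℝ) ^ (d - 1)) :=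
          mul_le_mul_of_nonneg_left hpoly (mul_nonneg hC.le (pow_nonneg hr0 t))
      _ = C * ((d : ℝ) + 3) ^ (d - 1) * ((t : ℝ) ^ (d - 1) * r ^ t) := by ring
      _ < c := hlt
  have hlow := kingS2Inf0_axis_ge hd t
  calc C * r ^ t < c / ((t : ℝ) + d + 2) ^ (d - 1) := by rw [lt_div_iff₀ hpos]; exact hkey
    _ = Real.exp (-kingS2Inf0 (0 : Fin (d + 1) → ℤ)) * (Real.Gamma (((d : ℝ) - 1) / 2) / (4 * Real.pi ^ (((d : ℝ) + 1) / 2) * ((t : ℝ) + d + 2) ^ (d - 1))) := by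
        rw [hc]; field_simp
    _ ≤ _ := mul_le_mul_of_nonneg_left hlow (Real.exp_nonneg _)

/-- ★★★ **THE MASSLESS BLOCK FIELD DOES NOT CLUSTER EXPONENTIALLY AT ANY RATE**: for every `m > 0`, `¬ HasTimeClustering μ⁰_∞ θ* S 𝓔₊ m` (`d + 1 ≥ 3`; witness `F = G = e^{iφ(0)}`, whose
truncated pairing is `≥ c∕(t+d+2)^{d−1}`). [cite: King1986, Thm 2.1 (2.22) p.654, (4.5) p.670; GlimmJaffe1987, §19.7 Thm. 19.7.1] -/
theorem king0_not_hasTimeClustering (hd : 2 ≤ d) {m : ℝ} (hm : 0 < m) :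
    ¬ HasTimeClustering (kingFieldInf0 d) (configReflect (latticeTimeReflection (d + 1))) (latticeTimeShift (d + 1) ℝ) (positiveTimeEvents (d + 1) ℝ) m := by
  intro h
  obtain ⟨C, hC⟩ := h _ _ (isBoundedMeasurable_onePoint (d := d)) (isBoundedMeasurable_onePoint (d := d))
  have hr1 : Real.exp (-m) < 1 := Real.exp_lt_one_iff.mpr (by linarith)
  obtain ⟨t, ht⟩ := exists_const_mul_pow_lt_onePoint0_lowerBound hd C (Real.exp_nonneg (-m)) hr1
  have hb := hC t
  rw [os_truncated_onePoint0_eq hd t, exp_neg_mul_nat_eq_pow] at hb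
  have hlow := os_truncated_onePoint0_norm_ge d (kingS2Inf0 (d := d)) t
  linarith

/-- ★★★ **THE MASSIVE BLOCK FIELD DOES NOT CLUSTER FASTER THAN ITS MASS**: for `m′ > √m²`, `¬ HasTimeClustering μ_∞ θ* S 𝓔₊ m′` (witness `F = G = e^{iφ(0)}`: its truncated pairing has
`t`-th root `→ e^{−√m²}`, incompatible with `≤ C e^{−m′t}`).  With part Ͳ-d₃'s `king_hasTimeClustering` the rate `√m²` is sharp. [cite: King1986, Thm 3.3 (3.6) p.656; GlimmJaffe1987, §19.7 Thm. 19.7.1] -/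
theorem king_not_hasTimeClustering_of_gt {m2 m' : ℝ} (hm : 0 < m2) (hm' : Real.sqrt m2 < m') :
    ¬ HasTimeClustering (kingFieldInf (d := d) m2) (configReflect (latticeTimeReflection (d + 1))) (latticeTimeShift (d + 1) ℝ) (positiveTimeEvents (d + 1) ℝ) m' := by
  intro h
  have hs : ∀ z ∈ ({0} : Finset (Fin (d + 1) → ℤ)), z ∈ positiveTimeSites (d + 1) := fun z hz => by
    rw [Finset.mem_singleton] at hz; subst hz
    show (0 : ℤ) ≤ (0 : Fin (d + 1) → ℤ) 0
    simp
  have hF := isBoundedMeasurable_trigPoly (d := d) (fun _ : Fin 1 => (1 : ℂ)) hs (fun _ _ => (1 : ℝ))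
  obtain ⟨C, hC⟩ := h _ _ hF hF
  -- `b_t ≤ C e^{-m' t}` for all `t`
  have hbd : ∀ t : ℕ, Real.exp (-kingS2Inf (d := d) m2 0) * kingS2Inf m2 ((Pi.single 0 1 : Fin (d + 1) → ℤ) + (t : ℤ) • (Pi.single 0 (1 : ℤ) : Fin (d + 1) → ℤ))
      ≤ C * Real.exp (-m') ^ t := fun t => by
    have hb := hC t
    rw [os_truncated_onePoint_eq (d := d) hm t, exp_neg_mul_nat_eq_pow] at hb
    exact (os_truncated_onePoint_norm_ge (d := d) m2 t).trans hb
  have hC0 : 0 < C := by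
    have h0 := hbd 0
    rw [pow_zero, mul_one] at h0
    exact (mul_pos (Real.exp_pos _) (kingS2Inf_pos hm _)).trans_le h0
  -- `t`-th roots: `b_t^{1/t} ≤ C^{1/t} e^{-m'}`, and `b_t^{1/t} → e^{-√m²}`, `C^{1/t} → 1`
  have hlim := tendsto_rpow_onePoint_lowerBound (d := d) hm
  have hlimC : Tendsto (fun t : ℕ => C ^ ((t : ℝ)⁻¹) * Real.exp (-m')) atTop (𝓝 (1 * Real.exp (-m'))) :=
    (tendsto_const_rpow_inv_nat hC0).mul tendsto_const_nhds
  rw [one_mul] at hlimC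
  have hle : Real.exp (-Real.sqrt m2) ≤ Real.exp (-m') := by
    refine le_of_tendsto_of_tendsto hlim hlimC ?_
    filter_upwards [eventually_ge_atTop 1] with t ht
    have ht0 : (0 : ℝ) < t := by exact_mod_cast ht
    have ha0 : 0 ≤ Real.exp (-kingS2Inf (d := d) m2 0) * kingS2Inf m2 ((Pi.single 0 1 : Fin (d + 1) → ℤ) + (t : ℤ) • (Pi.single 0 (1 : ℤ) : Fin (d + 1) → ℤ)) :=
      mul_nonneg (Real.exp_nonneg _) (kingS2Inf_pos hm _).le
    calc (Real.exp (-kingS2Inf (d := d) m2 0) * kingS2Inf m2 ((Pi.single 0 1 : Fin (d + 1) → ℤ) + (t : ℤ) • (Pi.single 0 (1 : ℤ) : Fin (d + 1) → ℤ))) ^ ((t : ℝ)⁻¹)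
        ≤ (C * Real.exp (-m') ^ t) ^ ((t : ℝ)⁻¹) := Real.rpow_le_rpow ha0 (hbd t) (by positivity)
      _ = C ^ ((t : ℝ)⁻¹) * Real.exp (-m') := by
          rw [Real.mul_rpow hC0.le (pow_nonneg (Real.exp_nonneg _) t), ← Real.rpow_natCast, ← Real.rpow_mul (Real.exp_nonneg _),
            mul_inv_cancel₀ ht0.ne', Real.rpow_one]
  rw [Real.exp_le_exp] at hle
  linarith

end Summit.QuantumFields.YangMills.BalabanUVNodes.N15KingModelRung.InfiniteVolume
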